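import Summits.HodgeConjecture.HodgeConjecture.Theses.HeckePrymWeil

/-!
# `WeilTwelvefoldsSqrtMinus7` (stmt-HodgeConjecture-1261) · Negative · typing of the Schoen lines (`stub_schoenLines`)

Negative-side / tightness knowledge for the crux `HeckePrymWeil.WeilTwelvefoldsSqrtMinus7`, from the standing
disprover's work file `Cruxes/WeilTwelvefoldsSqrtMinus7/Disproof.lean` §11a
(refuter-cdisprove-stmt-HodgeConjecture-1261-g4-0, cycle 4, 2026-08-16).  It concerns the stubs
`stub_schoenLines` and `stub_heckePrymWeilPlane` of the registered line
`Cruxes/WeilTwelvefoldsSqrtMinus7/Lines/isotypic-unimodular-saturation.lean`, which type the six Schoen /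
Patel–Zhang lines `⋀¹²(H¹(B)_{ψ^a}) ⊂ H¹²(B(ℂ); ℂ)` of the Prym `B = Prym(C̃ → C̃/N)` (`N = ⟨σ⟩ ≅ ℤ/7`,
`s = σ_*`) as the eigenspaces `Eig((2·𝟙_B + s_B)^*, (2 + ζ₇^a)^12)`, `ζ₇ = exp(2πi/7)`, and the Hecke
element `φ' = s + s² + s⁴ - s³ - s⁵ - s⁶` with `φ'² = -7`.  All unconditional, no geometry:

* `twoAddZeta7_prod_eq_pow_iff` (TYPING CERTIFICATE): on the summand `⊗_b ⋀^{k_b}H¹(B)_{ψ^b}` of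
  `⋀¹²H¹(B)`, `Σ_b k_b = 12`, the operator `(2·𝟙+s_B)^*` has eigenvalue `∏_{b=1}^{6}(2+ζ₇^b)^{k_b}`; this equals
  `(2+ζ₇^a)^{12}` IFF the multi-index is pure (`k_b = 0` for `b ≠ a`).  So the stub's eigenspace is EXACTLY the
  Schoen line (given `H^* = ⋀^*H¹` and Chevalley–Weil) — neither larger (which would make the stub assert
  algebraicity of non-Weil Hodge classes) nor smaller.  Mechanism: `N(2+ζ₇) = Φ₇(-2) = 43` is a prime `≡ 1 (7)`,
  so the conjugates `2+ζ₇^b` generate six distinct degree-one primes of `ℤ[ζ₇]`; formally `minpoly_ℤ ζ₇ = Φ₇`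
  (`eval_zmod43_eq_zero_of_aeval_ζ7`) and reduction `ζ₇ ↦ r_b ∈ 𝔽₄₃` modulo each of them (`exists_root43`,
  kernel `decide`).  The file introduces NO definitions (`ζ7` is a local notation).
* `oneAddZeta7_collision` (REFUTED ALTERNATIVE TYPING): `(1+ζ₇)⁵(1+ζ₇⁶)⁷ = (1+ζ₇)¹²` — with `(𝟙+s_B)^*` in
  place of `(2·𝟙+s_B)^*` mixed multi-indices collide with pure ones (`1+ζ̄ = ζ̄(1+ζ)` is a unit times `1+ζ`),
  confirming the planner's choice of `2·𝟙 + s_B`.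
* `gaussSum7_sq`: `(ζ₇+ζ₇²+ζ₇⁴-ζ₇³-ζ₇⁵-ζ₇⁶)² = -7` — the scalar identity inside `φ' ≫ φ' = -7`
  (certificate `g(X)²+7 = (X⁵+2X⁴-X³+X-6)(X⁷-1) + Φ₇(X)`).
-/

noncomputable section

set_option linter.dupNamespace false

open Complex Polynomial

namespace Summit.HodgeConjecture.HodgeConjecture.Theorems.WeilTwelvefoldsSqrtMinus7.Negative

/-- `ζ₇ = exp(2πi/7)`, spelled exactly as in `stub_schoenLines` (a notation, not a definition). -/
local notation "ζ7" => Complex.exp (2 * (Real.pi : ℂ) * Complex.I / 7)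

/-- `ζ₇` is a primitive 7th root of unity. [folklore] -/
theorem ζ7_isPrimitiveRoot : IsPrimitiveRoot ζ7 7 := by
  have h := Complex.isPrimitiveRoot_exp 7 (by norm_num)
  simpa using h

/-- `ζ₇⁷ = 1`. [folklore] -/
theorem ζ7_pow_seven : ζ7 ^ 7 = 1 := ζ7_isPrimitiveRoot.pow_eq_one

/-- `ζ₇ ≠ 1`. [folklore] -/
theorem ζ7_ne_one : ζ7 ≠ 1 := ζ7_isPrimitiveRoot.ne_one (by norm_num)

/-- `Φ₇(ζ₇) = 0`. [folklore] -/
theorem ζ7_cyclotomic : 1 + ζ7 + ζ7 ^ 2 + ζ7 ^ 3 + ζ7 ^ 4 + ζ7 ^ 5 + ζ7 ^ 6 = 0 := by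
  have h := ζ7_isPrimitiveRoot.geom_sum_eq_zero (by norm_num : 1 < 7)
  simpa [Finset.sum_range_succ] using h

/-- **Refuted alternative typing: `(𝟙 + s_B)^*` does NOT separate the Schoen lines** (the planner's remark,
now checked): `1 + ζ̄ = ζ̄ (1 + ζ)`, so e.g. the mixed multi-index `(5, 0,0,0,0, 7)` collides with the pure
one: `(1+ζ)^5 (1+ζ^6)^7 = (1+ζ)^12`. [folklore] -/
theorem oneAddZeta7_collision : (1 + ζ7) ^ 5 * (1 + ζ7 ^ 6) ^ 7 = (1 + ζ7) ^ 12 := by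
  have h7 := ζ7_pow_seven
  have h6 : 1 + ζ7 ^ 6 = ζ7 ^ 6 * (1 + ζ7) := by linear_combination -h7
  have h42 : (ζ7 ^ 6) ^ 7 = 1 := by
    rw [← pow_mul, show 6 * 7 = 7 * 6 from rfl, pow_mul, h7, one_pow]
  rw [h6, mul_pow, h42, one_mul]
  ring

/-- **The quadratic Gauss sum** (certifies the scalar part of `φ' ≫ φ' = -7` in `stub_heckePrymWeilPlane`):
`(ζ + ζ² + ζ⁴ - ζ³ - ζ⁵ - ζ⁶)² = -7`, so `η = s + s² + s⁴ - s³ - s⁵ - s⁶` has `η^{*2} = -7` on every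
`ψ^a`-eigenspace of `s^*`, `a ≠ 0` (on `ψ^a` the value is `(a/7)·(ζ+ζ²+ζ⁴-ζ³-ζ⁵-ζ⁶)`).  Certificate:
`g(X)² + 7 = (X⁵ + 2X⁴ - X³ + X - 6)(X⁷ - 1) + Φ₇(X)`. [folklore] -/
theorem gaussSum7_sq : (ζ7 + ζ7 ^ 2 + ζ7 ^ 4 - ζ7 ^ 3 - ζ7 ^ 5 - ζ7 ^ 6) ^ 2 = -7 := by
  have h7 : ζ7 ^ 7 = 1 := ζ7_pow_seven
  have hΦ := ζ7_cyclotomic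
  linear_combination (ζ7 ^ 5 + 2 * ζ7 ^ 4 - ζ7 ^ 3 + ζ7 - 6) * h7 + hΦ

/-- If an integer polynomial vanishes at `ζ₇` then `Φ₇` divides it (`minpoly_ℤ ζ₇ = Φ₇`, `ℤ` integrally
closed), so it vanishes at every root of `Φ₇` modulo `43`. [folklore] -/
theorem eval_zmod43_eq_zero_of_aeval_ζ7 (F : ℤ[X]) (hF : aeval ζ7 F = 0) (r : ZMod 43)
    (hr : (cyclotomic 7 (ZMod 43)).eval r = 0) :
    (F.map (Int.castRingHom (ZMod 43))).eval r = 0 := by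
  have hint : IsIntegral ℤ ζ7 := ζ7_isPrimitiveRoot.isIntegral (by norm_num)
  have hmin : cyclotomic 7 ℤ = minpoly ℤ ζ7 := cyclotomic_eq_minpoly ζ7_isPrimitiveRoot (by norm_num)
  have hdvd : cyclotomic 7 ℤ ∣ F := hmin ▸ minpoly.isIntegrallyClosed_dvd hint hF
  have hdvd' : cyclotomic 7 (ZMod 43) ∣ F.map (Int.castRingHom (ZMod 43)) := by
    have h := Polynomial.map_dvd (Int.castRingHom (ZMod 43)) hdvd
    rwa [map_cyclotomic] at h
  exact eval_eq_zero_of_dvd_of_eval_eq_zero hdvd' hr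

/-- `Φ₇` over `𝔽₄₃`, evaluated. [folklore] -/
theorem cyclotomic7_zmod43_eval (r : ZMod 43) :
    (cyclotomic 7 (ZMod 43)).eval r = 1 + r + r ^ 2 + r ^ 3 + r ^ 4 + r ^ 5 + r ^ 6 := by
  haveI : Fact (Nat.Prime 7) := ⟨by norm_num⟩
  rw [cyclotomic_prime, eval_finsetSum]
  simp only [eval_pow, eval_X, Finset.sum_range_succ, Finset.sum_range_zero]
  ring

/-- **The six primes over `43 = Φ₇(-2)` are distinct.**  For each `b ∈ {1,…,6}` there is a root `r` of `Φ₇` in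
`𝔽₄₃` (the reduction of `ζ₇` modulo the prime `(2 + ζ₇^b)`; explicitly `r = 41, 16, 11, 4, 35, 21`) with
`2 + r^b = 0` and `2 + r^a ≠ 0` for every other `a ∈ {1,…,6}` (kernel `decide`). [folklore] -/
theorem exists_root43 : ∀ b ∈ Finset.Icc 1 6, ∃ r : ZMod 43,
    1 + r + r ^ 2 + r ^ 3 + r ^ 4 + r ^ 5 + r ^ 6 = 0 ∧ (2 : ZMod 43) + r ^ b = 0 ∧
      ∀ a ∈ Finset.Icc 1 6, a ≠ b → (2 : ZMod 43) + r ^ a ≠ 0 := by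
  decide

/-- **Typing certificate for `stub_schoenLines`.** On `⊗_b ⋀^{k_b} H¹(B)_{ψ^b}` (`Σ k_b = 12`) the operator
`(2·𝟙_B + s_B)^*` has eigenvalue `∏_b (2 + ζ₇^b)^{k_b}`; it equals `(2 + ζ₇^a)^{12}` iff the multi-index is
PURE (`k_b = 0` for `b ≠ a`).  Reason: `N(2+ζ₇) = Φ₇(-2) = 43` is a prime `≡ 1 (7)`, so the six conjugates
`2 + ζ₇^b` generate six DISTINCT degree-one primes of `ℤ[ζ₇]`; formally, reduce modulo `(2+ζ₇^b)`
(`ζ₇ ↦ r_b ∈ 𝔽₄₃`, `exists_root43`), which kills the product and not `(2+ζ₇^a)^{12}` when `k_b ≠ 0`, `b ≠ a`.  Hence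
`Eig((2·𝟙+s_B)^*, (2+ζ₇^a)^12) = ⋀¹²H¹(B)_{ψ^a}` exactly — the Schoen line — given `H^* = ⋀^*H¹` and the
Chevalley–Weil dimensions: stub 1 is honestly typed (neither larger nor smaller than Patel–Zhang's summand).
[folklore] -/
theorem twoAddZeta7_prod_eq_pow_iff (a : ℕ) (ha : a ∈ Finset.Icc 1 6) (k : ℕ → ℕ)
    (hk : ∑ b ∈ Finset.Icc 1 6, k b = 12) :
    ∏ b ∈ Finset.Icc 1 6, (2 + ζ7 ^ b) ^ k b = (2 + ζ7 ^ a) ^ 12 ↔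
      ∀ b ∈ Finset.Icc 1 6, b ≠ a → k b = 0 := by
  constructor
  · intro h
    by_contra hne
    push Not at hne
    obtain ⟨b, hb, hba, hkb⟩ := hne
    set F : ℤ[X] := ∏ b ∈ Finset.Icc 1 6, (2 + X ^ b) ^ k b - (2 + X ^ a) ^ 12 with hFdef
    have hF : aeval ζ7 F = 0 := by
      simp only [hFdef, map_sub, map_prod, map_pow, map_add, aeval_X, map_ofNat]
      rw [h, sub_self]
    obtain ⟨r, hr, hrb, hrother⟩ := exists_root43 b hb
    have h0 := eval_zmod43_eq_zero_of_aeval_ζ7 F hF r (by rw [cyclotomic7_zmod43_eval, hr])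
    have hev : (F.map (Int.castRingHom (ZMod 43))).eval r = -((2 : ZMod 43) + r ^ a) ^ 12 := by
      simp only [hFdef, Polynomial.map_sub, Polynomial.map_prod, Polynomial.map_pow,
        Polynomial.map_add, Polynomial.map_X, Polynomial.map_ofNat, eval_sub, eval_prod, eval_pow,
        eval_add, eval_X, eval_ofNat]
      rw [Finset.prod_eq_zero hb (by rw [hrb, zero_pow hkb]), zero_sub]
    rw [hev, neg_eq_zero] at h0
    haveI : Fact (Nat.Prime 43) := ⟨by norm_num⟩
    exact hrother a ha (Ne.symm hba) ((pow_eq_zero_iff (by norm_num)).1 h0)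
  · intro h
    have hka : k a = 12 := by
      rw [Finset.sum_eq_single_of_mem a ha (fun b hb hba => h b hb hba)] at hk
      exact hk
    rw [Finset.prod_eq_single_of_mem a ha (fun b hb hba => by rw [h b hb hba, pow_zero]), hka]


end Summit.HodgeConjecture.HodgeConjecture.Theorems.WeilTwelvefoldsSqrtMinus7.Negative

end
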